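import Summits.RiemannHypothesis.RiemannHypothesis.Theorems.SoloInformedAnticlusteringRH
import HarnessLib

/-!
# Lemma 2k.E at every scale: jumping cells under RH (soloist)

Sorry-free.  The covering form of the local pair-correlation rigidity lemma (soloist's
`paper/sharpest.md` §2k (xi), Lemma 2k.E), at EVERY cell scale `1/b` with `1 ≤ b ≤ (log V)/4`,
not only at the scale `b ≍ log V` used for (AC*) in `SoloInformedAnticlusteringRH`:

**Theorem** (`jumping_cells_of_riemannHypothesis`).  Assume RH; let `Φ` be a Weil test with
`supp Φ ⊆ [−1, 1]` and `|Φ̂(1/2 + iu)|² ≥ μ > 0` for `|u| ≤ 2`.  There are `c > 0`, `t*`, `V₀`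
such that for all `t ≥ t*`, `V₀ ≤ V ≤ t` and `1 ≤ b ≤ (log V)/4`, among the `⌊bV⌋` cells
`[t + j/b, t + (j+1)/b]` at least `c · b · V` are cells on which `N(T) = zetaZeroCount T` jumps.

Equivalently: the ordinates of the zeros in `[t, t + V]` cannot be covered by fewer than `c b V`
of these cells — whereas their number is only `≍ V log t`, which for `b ≪ log t` would fit into
far fewer cells if they clustered.  The window condition is `V ≥ V₀` (a constant), not
`V ≥ log t`: the `log t` of the Riemann–von Mangoldt count and the `log t` of the archimedean bound
cancel.  Proof: `rigidity_window_moment` (T72h) with `a = 1`, `A = t`, `N = ⌊√V⌋`, `J = ⌊bV⌋`,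
the count `N(t + J/b) − N(t) ≥ V log t / (16π)` (`window_count_arith'`, from
`exists_zetaZeroCount_window_ge`) and the factor bound `rigidity_factor_le` (T72i).
-/

noncomputable section

open Real Complex MeasureTheory Set Filter Literature.NumberTheory.LFunctions

namespace Summit.RiemannHypothesis.RiemannHypothesis.Theorems

/-- Arithmetic of the Riemann–von Mangoldt lower count on a window of bounded-below length:
`V L/(16π) ≤ X/(2π)(L − 3) − C(2L + 1)` for `L ≥ 64`, `V ≥ 16πC + 8`, `X ≥ V − 1`. -/
theorem window_count_arith' {C L V X : ℝ} (hC : 0 < C) (hL : 64 ≤ L) (hV : 16 * π * C + 8 ≤ V)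
    (hX : V - 1 ≤ X) : V * L / (16 * π) ≤ X / (2 * π) * (L - 3) - C * (2 * L + 1) := by
  have hπC : 0 < π * C := by positivity
  have p1 : π * C * 64 ≤ π * C * L := mul_le_mul_of_nonneg_left hL hπC.le
  have p3 : (16 * π * C + 8) * (7 * L - 24) ≤ V * (7 * L - 24) :=
    mul_le_mul_of_nonneg_right hV (by linarith)
  have p5 : (V - 1) * (L - 3) ≤ X * (L - 3) := mul_le_mul_of_nonneg_right hX (by linarith)
  have key : V * L + 16 * π * C * (2 * L + 1) ≤ 8 * (X * (L - 3)) := by nlinarith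
  have e : X / (2 * π) * (L - 3) - C * (2 * L + 1) =
      (8 * (X * (L - 3)) - 16 * π * C * (2 * L + 1)) / (16 * π) := by
    field_simp
    ring
  rw [e]
  exact div_le_div_of_nonneg_right (by linarith) (by positivity)

set_option maxHeartbeats 400000 in
/-- **Lemma 2k.E, covering form, every scale (RH).**  See the module docstring. -/
theorem jumping_cells_of_riemannHypothesis (hRH : _root_.RiemannHypothesis) {Φ : ℝ → ℂ}
    (hΦ : IsWeilTest Φ) (ha : tsupport Φ ⊆ Icc (-1) 1) {μ : ℝ} (hμ0 : 0 < μ)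
    (hμ : ∀ u : ℝ, |u| ≤ 2 → μ ≤ ‖weilMellin Φ (1 / 2 + u * I)‖ ^ 2) :
    ∃ c tstar V₀ : ℝ, 0 < c ∧ ∀ t V b : ℝ, tstar ≤ t → V₀ ≤ V → V ≤ t → 1 ≤ b →
      4 * b ≤ Real.log V →
      c * b * V ≤ ((Finset.range ⌊b * V⌋₊).filter (fun j : ℕ ↦
        (zetaZeroCount (t + (j : ℝ) / b) : ℝ) < zetaZeroCount (t + ((j : ℝ) + 1) / b))).card := by
  obtain ⟨C, T₁, hC, hT₁, hRvM⟩ := exists_zetaZeroCount_window_ge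
  -- the constants of `Φ`
  obtain ⟨E, hE⟩ : ∃ E : ℝ, E = ∫ x : ℝ, ‖Φ x‖ ^ 2 := ⟨_, rfl⟩
  obtain ⟨D₁, hD₁⟩ : ∃ D₁ : ℝ, D₁ = ∫ x : ℝ, ‖deriv Φ x‖ := ⟨_, rfl⟩
  obtain ⟨JΦ, hJΦ⟩ : ∃ JΦ : ℝ, JΦ =
      ∫ v : ℝ, ‖weilMellin Φ (1 / 2 + v * I)‖ ^ 2 * Real.log (1 + |v|) := ⟨_, rfl⟩
  have hE0 : 0 ≤ E := hE ▸ integral_nonneg fun _ ↦ by positivity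
  have hD0 : 0 ≤ D₁ := hD₁ ▸ integral_nonneg fun _ ↦ norm_nonneg _
  have hJ0 : 0 ≤ JΦ := hJΦ ▸ integral_nonneg fun v ↦
    mul_nonneg (by positivity) (Real.log_nonneg (by linarith [abs_nonneg v]))
  obtain ⟨K₃, hK₃⟩ : ∃ K₃ : ℝ, K₃ = 12 * D₁ ^ 4 + 3 * (20 * E + JΦ) ^ 2 + 1188 * E ^ 2 + 1 :=
    ⟨_, rfl⟩
  have hK₃0 : 0 < K₃ := by rw [hK₃]; positivity
  refine ⟨μ ^ 2 / (256 * π ^ 2 * K₃), max T₁ (Real.exp 64), max (16 * π * C + 8) 64,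
    by positivity, fun t V b ht hV0 hVt hb1 hb4 ↦ ?_⟩
  -- sizes of `t` and `V`
  have htT : T₁ ≤ t := (le_max_left _ _).trans ht
  have hlogt : 64 ≤ Real.log t := by
    have h := Real.log_le_log (Real.exp_pos _) ((le_max_right _ _).trans ht)
    rwa [Real.log_exp] at h
  have hVC : 16 * π * C + 8 ≤ V := (le_max_left _ _).trans hV0
  have hV64 : 64 ≤ V := (le_max_right _ _).trans hV0
  have ht1 : 1 ≤ t := by linarith
  have hL1 : 1 ≤ Real.log t := by linarith
  have hb0 : 0 < b := by linarith
  -- the parameters `N`, `J`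
  obtain ⟨N, hN⟩ : ∃ N : ℕ, N = ⌊Real.sqrt V⌋₊ := ⟨_, rfl⟩
  have hsqV : Real.sqrt V ^ 2 = V := Real.sq_sqrt (by linarith)
  obtain ⟨hsq8, hsq1⟩ := sqrt_add_one_le hV64
  have hNle : (N : ℝ) ≤ Real.sqrt V := by rw [hN]; exact Nat.floor_le (Real.sqrt_nonneg _)
  have hNlt : Real.sqrt V < (N : ℝ) + 1 := by rw [hN]; exact Nat.lt_floor_add_one _
  have hN2 : (N : ℝ) ^ 2 ≤ V := by
    rw [← hsqV]; exact pow_le_pow_left₀ (Nat.cast_nonneg N) hNle 2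
  have hNt : (N : ℝ) + 1 ≤ t := by linarith
  have hbN : 2 * (1 * b) ≤ Real.log ((N : ℝ) + 1) := by
    have h1 : Real.log (Real.sqrt V ^ 2) = 2 * Real.log (Real.sqrt V) := by
      rw [Real.log_pow]; push_cast; ring
    rw [hsqV] at h1
    have h2 : Real.log (Real.sqrt V) ≤ Real.log ((N : ℝ) + 1) :=
      Real.log_le_log (by positivity) hNlt.le
    linarith
  have hbt : b ≤ Real.log t := by
    have h := Real.log_le_log (by positivity) hNt
    linarith [Real.log_nonneg (by linarith : (1 : ℝ) ≤ (N : ℝ) + 1)]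
  obtain ⟨J, hJ⟩ : ∃ J : ℕ, J = ⌊b * V⌋₊ := ⟨_, rfl⟩
  have hJle : (J : ℝ) ≤ b * V := by rw [hJ]; exact Nat.floor_le (by positivity)
  have hJlt : b * V < (J : ℝ) + 1 := by rw [hJ]; exact Nat.lt_floor_add_one _
  have hX : (J : ℝ) / b ≤ V := by rw [div_le_iff₀ hb0]; linarith
  have hX' : V - 1 ≤ (J : ℝ) / b := by rw [le_div_iff₀ hb0]; nlinarith
  have hX0 : (0 : ℝ) ≤ J / b := by positivity
  -- the occupied cells and T72h
  obtain ⟨Occ, hOcc⟩ : ∃ Occ : Finset ℕ, Occ = (Finset.range J).filter (fun j : ℕ ↦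
      (zetaZeroCount (t + (j : ℝ) / b) : ℝ) < zetaZeroCount (t + ((j : ℝ) + 1) / b)) :=
    ⟨_, rfl⟩
  obtain ⟨Sg, hSg⟩ : ∃ Sg : ℝ, Sg =
      ∑ n ∈ Finset.Icc 1 N, ArithmeticFunction.vonMangoldt n ^ 2 / (n : ℝ) := ⟨_, rfl⟩
  have hmom : b * μ ^ 2 * ((zetaZeroCount (t + J / b) : ℝ) - zetaZeroCount t) ^ 2 ≤
      Occ.card * (3 * (J / b) * ((2 * (Real.exp (b / 2) * D₁ / t) ^ 2) ^ 2 +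
        (E * (Real.log (3 + (t + J / b)) + 12 + Real.log π) + 1 / (2 * π) * JΦ) ^ 2) +
        12 * (J / b + 2 * (N : ℝ) ^ 2) * (E ^ 2 * Sg)) := by
    have h := rigidity_window_moment hRH hΦ zero_le_one ha hb1 hμ0.le hμ (N := N) hbN ht1 J
    rw [one_mul] at h
    rw [hOcc, hE, hD₁, hJΦ, hSg]
    exact h
  -- (1) the lower count and (2) the upper bound of the factor
  have hΔ : V * Real.log t / (16 * π) ≤ (zetaZeroCount (t + J / b) : ℝ) - zetaZeroCount t :=
    (window_count_arith' hC hlogt hVC hX').trans (hRvM t (J / b) htT hX0 (hX.trans hVt))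
  have hΔ0 : 0 ≤ V * Real.log t / (16 * π) := by positivity
  have hSg0 : 0 ≤ Sg := hSg ▸ Finset.sum_nonneg fun n _ ↦ by positivity
  have hSg1 : Sg ≤ 33 * Real.log t ^ 2 := by
    have h1 : Sg ≤ Real.log N * (22 * Real.log N + 11) := hSg ▸ sum_vonMangoldt_sq_div_le N
    have hl0 : 0 ≤ Real.log N := Real.log_nonneg (by linarith)
    have hlt : Real.log N ≤ Real.log t := Real.log_le_log (by linarith) (by linarith)
    exact h1.trans ((mul_le_mul hlt (by linarith : 22 * Real.log N + 11 ≤ 33 * Real.log t)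
      (by linarith) (by linarith)).trans_eq (by ring))
  have het : Real.exp (b / 2) ≤ t := by
    have h1 : Real.exp (b / 2) ≤ Real.exp (Real.log t) := Real.exp_le_exp.2 (by linarith)
    rwa [Real.exp_log (by linarith)] at h1
  have hlog : Real.log (3 + (t + J / b)) ≤ Real.log t + 4 := by
    have h5 : Real.log 5 ≤ 4 := by
      linarith [Real.log_le_sub_one_of_pos (by norm_num : (0 : ℝ) < 5)]
    have h2 : Real.log (3 + (t + J / b)) ≤ Real.log (5 * t) :=
      Real.log_le_log (by linarith) (by linarith)
    rw [Real.log_mul (by norm_num) (by linarith)] at h2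
    linarith
  have hF := rigidity_factor_le hX0 hX hN2 hE0 hD0 hJ0 hL1 ht1 het (Real.exp_pos _) hlog
    hSg0 hSg1
  rw [← hK₃] at hF
  -- (3) `#Occ ≥ b μ² V / (256 π² K₃)`
  have hc0 : (0 : ℝ) ≤ Occ.card := Nat.cast_nonneg _
  have k1 : b * μ ^ 2 * (V * Real.log t / (16 * π)) ^ 2 ≤
      b * μ ^ 2 * ((zetaZeroCount (t + J / b) : ℝ) - zetaZeroCount t) ^ 2 :=
    mul_le_mul_of_nonneg_left (pow_le_pow_left₀ hΔ0 hΔ 2) (by positivity)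
  have k2 := (k1.trans hmom).trans (mul_le_mul_of_nonneg_left hF hc0)
  have k3 : μ ^ 2 / (256 * π ^ 2 * K₃) * b * V * (K₃ * (V * Real.log t ^ 2)) ≤
      Occ.card * (K₃ * (V * Real.log t ^ 2)) :=
    calc μ ^ 2 / (256 * π ^ 2 * K₃) * b * V * (K₃ * (V * Real.log t ^ 2))
        = b * μ ^ 2 * (V * Real.log t / (16 * π)) ^ 2 := by
          field_simp
          ring
      _ ≤ _ := k2
      _ = Occ.card * (K₃ * (V * Real.log t ^ 2)) := by ring
  rw [hJ] at hOcc
  rw [← hOcc]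
  exact le_of_mul_le_mul_right k3 (by positivity)

end Summit.RiemannHypothesis.RiemannHypothesis.Theorems

end
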